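import Mathlib.Analysis.Analytic.Order
import Mathlib.Analysis.Complex.AbsMax
import Mathlib.Analysis.Complex.CauchyIntegral
import Mathlib.Analysis.SpecialFunctions.Pow.Complex
import Mathlib.Tactic.LinearCombination
import Literature.NumberTheory.EllipticCurves.RootNumber
import HarnessLib

/-!
# Barrier (BirchSwinnertonDyer): the functional equation sees the order of vanishing only modulo `2`

Barrier catalogue `Literature/Barriers/BirchSwinnertonDyer/` (D-0021), entry for the technique
class **functional equation / sign (root number) arguments** — conclusions about
`ord_{s=1} L(E, s)` that use, of the completed `L`-function `Λ(E, s)`, only that it is an entire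
function (real on the real axis) satisfying `Λ(E, 2 - s) = w(E) Λ(E, s)` with `w(E) = ±1`
(tree: `WeierstrassCurve.HasFunctionalEquationSign`, `WeierstrassCurve.rootNumber`, named facts
`completedLContinuation_two_sub`, `differentiable_completedLContinuation`, parity fact
`even_analyticRank_iff`).

What the sources print. T. Dokchitser, *Notes on the parity conjecture* (2013), §1.1, states the
Hasse–Weil conjecture with "`L*(E/K, 2 - s) = w(E/K) L*(E/K, s)`", BSD I
"`ord_{s=1} L(E/K, s) = rk E/K`", and: "One immediate consequence of the two conjectures above is
[the Parity Conjecture] `(-1)^{rk E/K} = w(E/K)`" — the functional equation converts the sign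
into the PARITY of the order of vanishing. Kellock–Dokchitser, *Root numbers and parity
phenomena*, Bull. LMS 55 (2023), §4: "if `ρ` is self-dual the parity of the order of vanishing of
`L(E/ℚ, ρ, s)` at `s = 1` is governed by `w(E/ℚ, ρ)`. For most elliptic curves, one expects the
order of vanishing of the twisted `L`-function to be as small as is allowed by the functional
equation. If `ρ` is not self-dual, the functional equation does not tell us anything about the
order of vanishing of `L(E/ℚ, ρ, s)` at `s = 1`."

This file makes "what the functional equation allows" a THEOREM about an explicit class of
functions:
* `signedFEClass w` — entire functions `Λ : ℂ → ℂ`, real on the real axis, with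
  `Λ (2 - s) = w * Λ s` for all `s` (the bare content of the signed functional equation at the
  weight-`2` centre `s = 1`);
* `sign_eq_neg_one_pow` — for ANY function analytic at `1` with `Λ (2 - s) = w Λ(s)` and
  `analyticOrderAt Λ 1 = n < ∞`, `w = (-1)ⁿ` (the parity constraint; Taylor expansion);
* `exists_mem_signedFEClass` — conversely, for every `n` with `(-1)ⁿ = w` the class contains a
  member of order exactly `n` at `s = 1` (`Λ(s) = (s - 1)ⁿ`);
* `sq_mul_mem_signedFEClass`, `analyticOrderAt_sq_mul`, `add_two_mem_centralOrders` — the class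
  is stable under `Λ ↦ (s - 1)² Λ`, which raises the central order by exactly `2`: starting from
  ANY member of finite order `n` (e.g. a completed `L`-function itself) the class contains members
  of order `n + 2, n + 4, …` agreeing with it away from `s = 1` up to the polynomial factor;
* `FunctionalEquationSeesOnlyParity` (the barrier `Prop`, PROVED as
  `functionalEquationSeesOnlyParity_holds`): for `w = ±1` the set of central orders of vanishing
  realised in `signedFEClass w` is EXACTLY the parity class `{n | (-1)ⁿ = w}` — the functional
  equation determines `ord_{s=1}` modulo `2` and nothing more;
* `exists_pair_of_ne_zero` — the non-self-dual shape `Λ₁(2 - s) = w Λ₂(s)` between two different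
  functions imposes no constraint at all on `ord_{s=1} Λ₁` ("does not tell us anything").

## Audit 2026-08-15 (barrier-audit, D-0021): NARROWED — `FunctionalEquationSeesOnlyParityNarrow`

What is proved (`functionalEquationSeesOnlyParity_holds`) is a statement about the BARE class
`signedFEClass w` — entire, real on `ℝ`, `Λ(2 - s) = w Λ(s)` — which carries no growth and no
normalisation axiom; its completeness half rests on the witnesses `(s - 1)ⁿ` and on the closure
`Λ ↦ (s - 1)² Λ`, both of which discard all a-priori size information. The audit tests the first
enrichment of the class that a sign argument on a genuine completed `L`-function has for free from
the Dirichlet series and the functional equation: a bound `‖Λ‖ ≤ M` on one circle `‖s - 1‖ = R`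
(`R ≥ 1`; for `Λ(E, s)` a convexity bound, the functional equation supplying the left half) and
a lower bound `m ≤ ‖Λ(2)‖` at the edge of absolute convergence (`Λ(E, 2) = N L(E,2)/(4π²) > 0`
by the Euler product). On this sub-class "nothing more than parity" FAILS: the quotient
`Λ(s)/(s - 1)ⁿ` is entire, the maximum modulus principle on the disc gives
`‖Λ(z)‖ ≤ M (‖z - 1‖/R)ⁿ` (`norm_le_of_analyticOrderAt_eq`, Schwarz lemma with multiplicity),
hence `m Rⁿ ≤ M`, i.e. `ord_{s=1} Λ ≤ log(M/m)/log R` (`mul_pow_le_of_analyticOrderAt_eq`); and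
that is all — every `n` with `(-1)ⁿ = w` and `m Rⁿ ≤ M` is realised by `m (s - 1)ⁿ`
(`scaledMonomial_mem_signedFEClass`). The corrected record is the closed `Prop`
`FunctionalEquationSeesOnlyParityNarrow` (realised orders in the normalised class `=` parity
class `∩ {n | m Rⁿ ≤ M}`), PROVED (`functionalEquationSeesOnlyParityNarrow_holds`); the old
statement is its growth-blind limit (`functionalEquationSeesOnlyParity_of_narrow`). In print the
functional equation is used beyond parity in exactly this way — zero counting and Weil's explicit
formula bound the central order by the conductor: unconditionally "`r ≪ log k²N`", indeed "la
majoration très simple : `r ≤ log k²N`" from test functions with `Re Φ ≥ 0` on the critical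
strip, and "pour de petits niveaux `N`, les majorations obtenues sont généralement assez
précises" (Mestre 1986, Introduction p. 210 and §II.1.1 pp. 216–217); under GRH
`ord_{s=k/2} L ≤ A log k²N / log log k²N` (ibid., Prop. II.1, p. 218) and, for elliptic curves,
"`r ≤ 0,268 log N + 1,03`" from `N` alone with the trivial bound `|a_p| ≤ 2√p` (ibid., §II.2
p. 220: `N = 11` gives `r ≤ 1`, parity then `r = 0`); "`r(E) ≤ 11 log T/log log T` … Such
results are already known (see Mestre and Brumer)" (Heath-Brown 2004, §1, under RH). For the
summit (`E/ℚ`, conductor unbounded) these conductor-dependent bounds separate no rank `n` from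
`n + 2` in general (`mem_and_add_two_mem_of_mul_pow_le`), so the `blocks:` line of the entry
stands for growth-blind AND growth-aware sign arguments once `log(M/m)/log R ≥ 2`; what the
audit removes is the word "nothing": the dividing line is coefficient-blindness, not the
functional equation. A second boundary lies outside the single-sign model: for NON-primitive
`L`-functions the signs of the self-dual FACTORS force high-order central zeros —
`ord_{s=1} L(E/F, s) ≥ n` for `Gal(F/ℚ) = D_{2n}` under the Heegner hypothesis
(Kellock–Dokchitser 2023, §3.16 Prop. 3.54) — void for the primitive degree-`2` function
`L(E/ℚ, s)` of the summit, not for routes that pass through base change.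

## References (read for this entry; locators as printed)

* T. Dokchitser, *Notes on the parity conjecture*, in: Elliptic Curves, Hilbert Modular Forms
  and Galois Deformations, Birkhäuser (2013) (arXiv:1009.5389), §1.1 (Hasse–Weil Conjecture,
  BSD I, Parity Conjecture "one immediate consequence"; Thm. 1) (`Dokchitser2013ParityNotes`).
* L. C. Kellock, V. Dokchitser, *Root numbers and parity phenomena*, Bull. Lond. Math. Soc. 55
  (2023) 2557–2597 (arXiv:2303.07883), §4 (the passage quoted; Conj. 4.3, minimalist conjecture
  for twists), §3.16 Prop. 3.54 (Heegner hypothesis ⇒ odd order) (`KellockDokchitser2023`).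
* T. Dokchitser, V. Dokchitser, Ann. of Math. 172 (2010), §1 (Conj. 1.1 parity, Conj. 1.2
  `p`-parity) and Thm. 1.4 (`DokchitserDokchitserAnnals2010`).
* B. J. Birch, H. P. F. Swinnerton-Dyer, J. reine angew. Math. 218 (1965), §7 (parity of the
  analytic rank from the sign; as cited by the tree fact `even_analyticRank_iff`)
  (`BirchSwinnertonDyer1965Notes2`).
* J.-F. Mestre, *Formules explicites et minorations de conducteurs de variétés algébriques*,
  Compositio Math. 58 (1986) 209–232: Introduction p. 210 ("`r ≪ log k²N`"; under RH
  "`r = O(log k²N/log log k²N)`"), §II.1.1 pp. 216–217 (bounds without GRH, "`r ≤ log k²N`"),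
  §II.1.2 and Prop. II.1 p. 218 (GRH), §II.2 pp. 218–221 ("`r ≤ 0,268 log N + 1,03`", table of
  least conductors per rank, parity refinement) (`Mestre1986FormulesExplicites`; Numdam scan read
  for the audit of 2026-08-15).
* D. R. Heath-Brown, *The average analytic rank of elliptic curves*, Duke Math. J. 122 (2004)
  591–623 (arXiv:math/0305114), §1 ("`r(E) ≤ 11 log T / log log T` … already known (see Mestre
  and Brumer)", under RH for the `L(E_{r,s}, s)`) (`Heathbrown2004`; audit 2026-08-15).
-/

noncomputable section

open scoped Classical Topology

open Filter

namespace Literature.Barriers.BirchSwinnertonDyer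

/-! ### The technique class -/

/-- **The signed functional-equation class** at the weight-`2` centre `s = 1`: entire functions
`Λ : ℂ → ℂ`, real on the real axis, satisfying `Λ(2 - s) = w · Λ(s)` for all `s` — the bare
analytic content of "`L*(E/K, 2 - s) = w(E/K) L*(E/K, s)`" (Dokchitser 2013, §1.1) retained by a
sign/functional-equation argument. [cite: Dokchitser2013ParityNotes, §1.1 (Hasse–Weil Conjecture)] -/
def signedFEClass (w : ℂ) : Set (ℂ → ℂ) :=
  {Λ | Differentiable ℂ Λ ∧ (∀ x : ℝ, (Λ x).im = 0) ∧ ∀ s, Λ (2 - s) = w * Λ s}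

/-- Membership in `signedFEClass`, unfolded. [folklore] -/
theorem mem_signedFEClass_iff {w : ℂ} {Λ : ℂ → ℂ} :
    Λ ∈ signedFEClass w ↔
      Differentiable ℂ Λ ∧ (∀ x : ℝ, (Λ x).im = 0) ∧ ∀ s, Λ (2 - s) = w * Λ s :=
  Iff.rfl

/-- **The set of central orders of vanishing realised in the class**: those `n : ℕ` for which
some `Λ ∈ signedFEClass w` has `analyticOrderAt Λ 1 = n`. [folklore] -/
def centralOrders (w : ℂ) : Set ℕ :=
  {n | ∃ Λ ∈ signedFEClass w, analyticOrderAt Λ 1 = n}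

/-! ### The functional equation forces the parity of the order … -/

/-- **Parity constraint.** If `Λ` is analytic at `1`, satisfies `Λ(2 - s) = w Λ(s)` for all `s`,
and vanishes to finite order `n` at `s = 1`, then `w = (-1)ⁿ`. Proof: write
`Λ(z) = (z - 1)ⁿ g(z)` near `1` with `g(1) ≠ 0`; the functional equation gives
`(-1)ⁿ g(2 - z) = w g(z)` on a punctured neighbourhood of `1`; let `z → 1`. This is the step
"functional equation ⇒ `(-1)^{ord} = w`" behind "One immediate consequence … is the Parity
Conjecture" (Dokchitser 2013, §1.1) and behind the tree fact `even_analyticRank_iff`.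
[cite: Dokchitser2013ParityNotes, §1.1] [cite: BirchSwinnertonDyer1965Notes2, §7] -/
theorem sign_eq_neg_one_pow {w : ℂ} {Λ : ℂ → ℂ} (hΛ : AnalyticAt ℂ Λ 1)
    (hFE : ∀ s, Λ (2 - s) = w * Λ s) {n : ℕ} (hn : analyticOrderAt Λ 1 = n) :
    w = (-1) ^ n := by
  obtain ⟨g, hg, hg0, hev⟩ := hΛ.analyticOrderAt_eq_natCast.mp hn
  have h2 : Tendsto (fun z : ℂ => 2 - z) (𝓝 1) (𝓝 1) := by
    have hc : Continuous (fun z : ℂ => 2 - z) := by fun_prop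
    have := hc.tendsto 1
    norm_num at this
    exact this
  have hev' : ∀ᶠ z in 𝓝 (1 : ℂ), Λ (2 - z) = ((2 - z) - 1) ^ n • g (2 - z) := h2.eventually hev
  have key : ∀ᶠ z in 𝓝[≠] (1 : ℂ), (-1) ^ n * g (2 - z) = w * g z := by
    have hboth : ∀ᶠ z in 𝓝[≠] (1 : ℂ),
        Λ z = (z - 1) ^ n • g z ∧ Λ (2 - z) = ((2 - z) - 1) ^ n • g (2 - z) :=
      (hev.and hev').filter_mono nhdsWithin_le_nhds
    have hne : ∀ᶠ z in 𝓝[≠] (1 : ℂ), z ≠ 1 := eventually_mem_nhdsWithin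
    filter_upwards [hboth, hne] with z ⟨h1, h1'⟩ hz
    have hFEz := hFE z
    rw [h1', h1] at hFEz
    simp only [smul_eq_mul] at hFEz
    have hz' : (z - 1) ^ n ≠ 0 := pow_ne_zero _ (sub_ne_zero.mpr hz)
    have e : (2 - z - 1 : ℂ) = (-1) * (z - 1) := by ring
    rw [e, mul_pow] at hFEz
    apply mul_left_cancel₀ hz'
    linear_combination hFEz
  have hlim1 : Tendsto (fun z => (-1 : ℂ) ^ n * g (2 - z)) (𝓝[≠] 1) (𝓝 ((-1) ^ n * g 1)) := by
    have : Tendsto (fun z => g (2 - z)) (𝓝 (1 : ℂ)) (𝓝 (g 1)) := hg.continuousAt.tendsto.comp h2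
    exact (this.const_mul _).mono_left nhdsWithin_le_nhds
  have hlim2 : Tendsto (fun z => w * g z) (𝓝[≠] 1) (𝓝 (w * g 1)) :=
    (hg.continuousAt.tendsto.const_mul w).mono_left nhdsWithin_le_nhds
  have heq : (-1 : ℂ) ^ n * g 1 = w * g 1 := tendsto_nhds_unique (hlim1.congr' key) hlim2
  exact (mul_right_cancel₀ hg0 heq).symm

/-- **Parity constraint inside the class**: every central order realised in `signedFEClass w`
satisfies `(-1)ⁿ = w`. [cite: Dokchitser2013ParityNotes, §1.1] -/
theorem neg_one_pow_eq_of_mem_centralOrders {w : ℂ} {n : ℕ} (hn : n ∈ centralOrders w) :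
    (-1 : ℂ) ^ n = w := by
  obtain ⟨Λ, ⟨hd, -, hFE⟩, hord⟩ := hn
  exact (sign_eq_neg_one_pow (Differentiable.analyticAt hd 1) hFE hord).symm

/-- **The tree's functional-equation datum yields exactly this parity constraint.** For a
Weierstrass curve `W` over `ℚ`, an entire continuation `Λ ∈ W.completedLContinuations N_W` of the
completed `L`-function (tree `WeierstrassCurve.completedLContinuations`, `N_W = W.conductorNorm ℤ`)
satisfying `Λ(2 - s) = ε Λ(s)` — i.e. a witness of the tree's `W.HasFunctionalEquationSign ε` — and
vanishing to finite order `n` at `s = 1`: `ε = (-1)ⁿ` in `ℂ`. (For elliptic `W`, `ε = W.rootNumber`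
by the tree facts `hasFunctionalEquationSign_rootNumber`, `hasFunctionalEquationSign_unique`; the
parity of `W.analyticRank` is the tree fact `even_analyticRank_iff`.)
[cite: Dokchitser2013ParityNotes, §1.1] [cite: BirchSwinnertonDyer1965Notes2, §7] -/
theorem intCast_eq_neg_one_pow_of_mem_completedLContinuations (W : WeierstrassCurve ℚ) {ε : ℤ}
    {Λ : ℂ → ℂ} (hΛ : Λ ∈ W.completedLContinuations (W.conductorNorm ℤ))
    (hFE : ∀ s, Λ (2 - s) = ε * Λ s) {n : ℕ} (hn : analyticOrderAt Λ 1 = n) :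
    (ε : ℂ) = (-1) ^ n :=
  sign_eq_neg_one_pow (Differentiable.analyticAt hΛ.1 1) hFE hn

/-! ### … and nothing else: every order of the right parity is realised -/

/-- The centred monomial `(s - 1)ⁿ` is entire, real on `ℝ`, satisfies the functional equation with
sign `(-1)ⁿ` and vanishes to order exactly `n` at `s = 1`. [folklore] -/
theorem centeredMonomial_mem_signedFEClass (n : ℕ) :
    (fun s : ℂ => (s - 1) ^ n) ∈ signedFEClass ((-1) ^ n) ∧
      analyticOrderAt (fun s : ℂ => (s - 1) ^ n) 1 = n := by
  refine ⟨⟨by fun_prop, fun x => ?_, fun s => ?_⟩, ?_⟩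
  · show (((x : ℂ) - 1) ^ n).im = 0
    rw [show ((x : ℂ) - 1) ^ n = (((x - 1) ^ n : ℝ) : ℂ) by push_cast; ring]
    exact Complex.ofReal_im _
  · show ((2 : ℂ) - s - 1) ^ n = (-1) ^ n * (s - 1) ^ n
    rw [show (2 : ℂ) - s - 1 = (-1) * (s - 1) by ring, mul_pow]
  · have e : (fun s : ℂ => (s - 1) ^ n) = (· - (1 : ℂ)) ^ n := by
      ext s; simp
    rw [e]
    exact analyticOrderAt_centeredMonomial

/-- **Completeness of the parity constraint.** For every `n` with `(-1)ⁿ = w` there is a member of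
`signedFEClass w` vanishing to order exactly `n` at `s = 1` — the functional equation "allows"
every such order ("one expects the order of vanishing … to be as small as is allowed by the
functional equation", Kellock–Dokchitser 2023, §4: the allowance is a parity class, not a bound).
[cite: KellockDokchitser2023, §4] -/
theorem exists_mem_signedFEClass {w : ℂ} {n : ℕ} (hw : (-1 : ℂ) ^ n = w) :
    ∃ Λ ∈ signedFEClass w, analyticOrderAt Λ 1 = n := by
  subst hw
  exact ⟨_, (centeredMonomial_mem_signedFEClass n).1, (centeredMonomial_mem_signedFEClass n).2⟩

/-- **The class is stable under multiplication by `(s - 1)²`**, which preserves entirety, reality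
and the signed functional equation (`(1 - s)² = (s - 1)²`). [folklore] -/
theorem sq_mul_mem_signedFEClass {w : ℂ} {Λ : ℂ → ℂ} (h : Λ ∈ signedFEClass w) :
    (fun s : ℂ => (s - 1) ^ 2 * Λ s) ∈ signedFEClass w := by
  obtain ⟨hd, hre, hFE⟩ := h
  refine ⟨by fun_prop, fun x => ?_, fun s => ?_⟩
  · show (((x : ℂ) - 1) ^ 2 * Λ x).im = 0
    rw [show ((x : ℂ) - 1) ^ 2 = (((x - 1) ^ 2 : ℝ) : ℂ) by push_cast; ring, Complex.im_ofReal_mul,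
      hre x, mul_zero]
  · show ((2 : ℂ) - s - 1) ^ 2 * Λ (2 - s) = w * ((s - 1) ^ 2 * Λ s)
    rw [hFE s]
    ring

/-- **… and multiplication by `(s - 1)²` raises the central order by exactly `2`.** So from ANY
member of finite central order `n` (for instance the completed `L`-function of a given curve) the
class produces members of order `n + 2, n + 4, …` with the same behaviour away from `s = 1`: the
functional equation cannot separate `n` from `n + 2`. [folklore] -/
theorem analyticOrderAt_sq_mul {Λ : ℂ → ℂ} (hΛ : AnalyticAt ℂ Λ 1) :
    analyticOrderAt (fun s : ℂ => (s - 1) ^ 2 * Λ s) 1 = analyticOrderAt Λ 1 + 2 := by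
  have e : (fun s : ℂ => (s - 1) ^ 2 * Λ s) = (· - (1 : ℂ)) ^ 2 * Λ := by
    ext s; simp
  rw [e, analyticOrderAt_mul (by fun_prop) hΛ, analyticOrderAt_centeredMonomial, add_comm]
  rfl

/-- **Closure of the realised orders under `n ↦ n + 2`.** [folklore] -/
theorem add_two_mem_centralOrders {w : ℂ} {n : ℕ} (hn : n ∈ centralOrders w) :
    n + 2 ∈ centralOrders w := by
  obtain ⟨Λ, hΛ, hord⟩ := hn
  refine ⟨_, sq_mul_mem_signedFEClass hΛ, ?_⟩
  rw [analyticOrderAt_sq_mul (Differentiable.analyticAt hΛ.1 1), hord]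
  rfl

/-! ### The barrier -/

/-- **Barrier (named statement, PROVED below): the functional equation sees `ord_{s=1}` only
modulo `2`.** For each sign `w ∈ {1, -1}`, the set of central orders of vanishing realised by
entire functions, real on `ℝ`, with `Λ(2 - s) = w Λ(s)` (`centralOrders w`, over the class
`signedFEClass w`) is EXACTLY the parity class `{n | (-1)ⁿ = w}`: the functional equation with
its sign determines the parity of the order of vanishing (Dokchitser 2013, §1.1: the Parity
Conjecture is the "immediate consequence" of Hasse–Weil + BSD) and NOTHING further — every order
of that parity occurs. Kellock–Dokchitser 2023, §4: the order is expected "as small as is allowed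
by the functional equation", and for non-self-dual twists "the functional equation does not tell
us anything about the order of vanishing".

BARRIER (D-0021), one line per key:
* technique_class: functional-equation root-number sign arguments — formally `signedFEClass w` (entire, real on `ℝ`, `Λ(2 - s) = w Λ(s)`): any conclusion about `ord_{s=1}` that holds for EVERY member of the class, i.e. that uses of `Λ(E, s)` only the tree facts `differentiable_completedLContinuation`, `completedLContinuation_two_sub` and the value of `WeierstrassCurve.rootNumber`.
* blocks: determining `W.analyticRank` — hence `BirchSwinnertonDyer` (`Literature.BSDRankConjecture`) through the analytic side — beyond its parity by such arguments: no bound `analyticRank ≤ 1`, no separation of analytic rank `0` from `2` or `1` from `3`, no lower bound `2 ≤ analyticRank` can follow from the signed functional equation alone, since `centralOrders w` contains every `n ≡ (1 - w)/2 (mod 2)` (theorem `exists_mem_signedFEClass`); what DOES follow is exactly parity [cite: Dokchitser2013ParityNotes, §1.1] (tree `even_analyticRank_iff`, route `Squeeze` clause PAR), which leaves the rank side to the `p`-parity theorem `corank Sel_{p^∞} ≡ ord (mod 2)` [cite: DokchitserDokchitserAnnals2010, Thm. 1.4] and to finiteness of `Ш` [cite: Dokchitser2013ParityNotes, §1.1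 Thm. 1]; for twists by non-self-dual Artin representations not even parity is available [cite: KellockDokchitser2023, §4].
* because: if `Λ(z) = (z - 1)ⁿ g(z)` with `g(1) ≠ 0` then `Λ(2 - z) = w Λ(z)` reads `(-1)ⁿ g(2 - z) = w g(z)` near `1`, so `w = (-1)ⁿ` (theorem `sign_eq_neg_one_pow`; "one immediate consequence" [cite: Dokchitser2013ParityNotes, §1.1]); conversely `(s - 1)ⁿ` is entire, real, satisfies the functional equation with sign `(-1)ⁿ` and has order `n` (theorem `centeredMonomial_mem_signedFEClass`), and `Λ ↦ (s - 1)² Λ` keeps every member in the class while raising its order by `2` (theorems `sq_mul_mem_signedFEClass`, `add_two_mem_centralOrders`), so the functional equation "allows" all orders of one parity [cite: KellockDokchitser2023, §4 ("as small as is allowed by the functional equation")]; a relation `Λ₁(2 - s) = w Λ₂(s)` between two DIFFERENT functions constrains nothing (theorem `exists_pair_of_ne_zero`) [cite: KellockDokchitser2023, §4 ("does not tell us anything")].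
* evasions_known: use VALUES and DERIVATIVES, not the symmetry: `r = 0 ⇔ L(E,1) ≠ 0` decided exactly via `L(E,1)/Ω ∈ ℚ`, `r = 1` via Gross–Zagier heights, numerically certified non-vanishing of `L^{(k)}(E,1)` for upper bounds (barrier `NumericalVanishingBarrier` and its evasions) [cite: Dokchitser2013ParityNotes, §1.1 (BSD I)]; on the arithmetic side parity is genuinely available and useful — `p`-parity for all `E/ℚ` [cite: DokchitserDokchitserAnnals2010, Thm. 1.4], parity of `rk E/K` from finiteness of the `2`- and `3`-primary parts of `Ш` [cite: Dokchitser2013ParityNotes, §1.1 Thm. 1], root-number computations forcing odd order under the Heegner hypothesis [cite: KellockDokchitser2023, §3.16 Prop. 3.54] and predicting points of infinite order "without having to construct them" [cite: KellockDokchitser2023, Abstract]; the minimalist expectation `ord ∈ {0, 1}` for generic curves/twists is a CONJECTURE about values, not a consequence of the functional equation [cite: KellockDokchitser2023, §4 Conj. 4.3].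
* scope_caveats: (a) a relativisation-type statement about the BARE class `signedFEClass w` (entire + real on `ℝ` + signed functional equation at the weight-`2` centre): the completed `L`-function of an elliptic curve satisfies much more (Euler product of degree `2`, Ramanujan bounds, decay in vertical strips, automorphy), and nothing here asserts that such richer axiom systems cannot constrain the central order — the sources quoted make no claim either way; (b) only the symmetry `s ↦ 2 - s` with constant sign `w` is modelled (no `N^{s/2}`/Gamma bookkeeping: these are absorbed in `Λ`), matching the tree's `HasFunctionalEquationSign`; (c) the identification `analyticOrderAt Λ(E,·) 1 = W.analyticRank` (non-vanishing of the Gamma factor at `1`) and the tree fact `even_analyticRank_iff` are not re-derived here; (d) `sign_eq_neg_one_pow` needs analyticity at `1` and FINITE order (`analyticOrderAt Λ 1 = n`); for `Λ ≡ 0` near `1` (order `⊤`) the sign is unconstrained; (e) the entry concerns the analytic side only and says nothing about Selmer or Mordell–Weil parity (see `RankNotSumOfLocalInvariants`, `SelmerVersusMordellWeil`); (f) AUDIT 2026-08-15 — NARROWED: "nothing further" holds for the bare class only because it has no growth or normalisation axiom (the witnesses `(s - 1)ⁿ` and `(s - 1)² Λ` have arbitrary size); the "i.e." of the technique_class line is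 too generous — the tree facts `differentiable_completedLContinuation`, `completedLContinuation_two_sub` concern `W.completedLContinuation N_W`, which by definition agrees with `N^{s/2}(2π)^{-s}Γ(s)L(E,s)` on `Re s > 3/2` (`WeierstrassCurve.completedLContinuations`), so an argument "using only" them still sees the Dirichlet series, `Λ(E,2) > 0` and convexity growth; with a bound `‖Λ‖ ≤ M` on a circle `‖s - 1‖ = R ≥ 1` and `m ≤ ‖Λ(2)‖` the realised central orders are EXACTLY `{n | (-1)ⁿ = w ∧ m Rⁿ ≤ M}` — parity AND `n ≤ log(M/m)/log R` (`FunctionalEquationSeesOnlyParityNarrow`, end of this file, proved) — the disc form of the zero-counting / explicit-formula bounds `r ≪ log k²N` unconditionally and `≪ log k²N/log log k²N` under GRH [cite: Mestre1986FormulesExplicites, Introduction p. 210, §II.1.1 pp. 216–217 and Prop. II.1 p. 218] [cite: Heathbrown2004, §1]; at unbounded conductor this changes no separation claim of the `blocks:` line, but for small conductor the same mechanism fed with the coefficients is sharp ("`r ≤ 0,268 log N + 1,03`" under GRH from `N` alone [cite: Mestre1986FormulesExplicites, §II.2 p. 220]); (g) AUDIT 2026-08-15: the single-sign model does not cover Artin-formalism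 factorisations, where the root numbers of self-dual factors force `ord_{s=1} L(E/F, s) ≥ n` beyond the parity of `w(E/F)` [cite: KellockDokchitser2023, §3.16 Prop. 3.54] — void for the primitive `L(E/ℚ, s)`.
* status: established (theorem `functionalEquationSeesOnlyParity_holds`, proved here); audited 2026-08-15: NARROWED — corrected record `FunctionalEquationSeesOnlyParityNarrow` (same file, proved)

[cite: Dokchitser2013ParityNotes, §1.1] [cite: KellockDokchitser2023, §4] -/
def FunctionalEquationSeesOnlyParity : Prop :=
  ∀ w : ℂ, (w = 1 ∨ w = -1) → centralOrders w = {n : ℕ | (-1 : ℂ) ^ n = w}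

/-- **`FunctionalEquationSeesOnlyParity` holds**: `⊆` is the parity constraint
`neg_one_pow_eq_of_mem_centralOrders`, `⊇` is `exists_mem_signedFEClass` (the hypothesis
`w = ±1` is not even needed). [cite: Dokchitser2013ParityNotes, §1.1] [cite: KellockDokchitser2023, §4] -/
theorem functionalEquationSeesOnlyParity_holds : FunctionalEquationSeesOnlyParity := by
  intro w _
  ext n
  exact ⟨neg_one_pow_eq_of_mem_centralOrders, fun hn => exists_mem_signedFEClass hn⟩

/-- **Both parity classes are infinite inside the class**: for `w = 1` every EVEN order and for
`w = -1` every ODD order is realised — so no upper bound on `ord_{s=1}` (in particular not the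
minimalist `ord ≤ 1`) follows from the signed functional equation. [cite: KellockDokchitser2023, §4] -/
theorem mem_centralOrders_of_even_of_odd (k : ℕ) :
    2 * k ∈ centralOrders 1 ∧ 2 * k + 1 ∈ centralOrders (-1) :=
  ⟨exists_mem_signedFEClass (by rw [pow_mul]; norm_num),
    exists_mem_signedFEClass (by rw [pow_succ, pow_mul]; norm_num)⟩

/-! ### Non-self-dual functional equations constrain nothing -/

/-- **"If `ρ` is not self-dual, the functional equation does not tell us anything about the order
of vanishing"** (Kellock–Dokchitser 2023, §4), formally: for every `w ≠ 0` and EVERY `n : ℕ`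
there are entire functions `Λ₁, Λ₂` with `Λ₁(2 - s) = w Λ₂(s)` for all `s` and
`analyticOrderAt Λ₁ 1 = n` (take `Λ₁(s) = (s - 1)ⁿ`, `Λ₂(s) = w⁻¹ Λ₁(2 - s)`).
[cite: KellockDokchitser2023, §4] -/
theorem exists_pair_of_ne_zero {w : ℂ} (hw : w ≠ 0) (n : ℕ) :
    ∃ Λ₁ Λ₂ : ℂ → ℂ, Differentiable ℂ Λ₁ ∧ Differentiable ℂ Λ₂ ∧
      (∀ s, Λ₁ (2 - s) = w * Λ₂ s) ∧ analyticOrderAt Λ₁ 1 = n := by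
  refine ⟨fun s => (s - 1) ^ n, fun s => w⁻¹ * ((2 - s) - 1) ^ n, by fun_prop, by fun_prop,
    fun s => ?_, (centeredMonomial_mem_signedFEClass n).2⟩
  simp only
  rw [← mul_assoc, mul_inv_cancel₀ hw, one_mul]

/-! ### Audit 2026-08-15 (D-0021): growth normalisation — the functional equation with ONE size
datum bounds the central order (NARROWED record `FunctionalEquationSeesOnlyParityNarrow`) -/

section NarrowGrowth

open Metric

/-- **Schwarz lemma with multiplicity at the centre.** If `Λ` is entire, bounded by `M` on the
circle `‖s - 1‖ = R` (`R > 0`) and vanishes to order exactly `n` at `s = 1`, then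
`‖Λ(z)‖ ≤ (M / Rⁿ) · ‖z - 1‖ⁿ` on the closed disc `‖z - 1‖ ≤ R`: the quotient `Λ(s)/(s - 1)ⁿ`
extends to an entire function (removable singularity, from the local factorisation
`Λ = (s - 1)ⁿ • g` of `AnalyticAt.analyticOrderAt_eq_natCast`), to which the maximum modulus
principle on the disc applies (`Complex.norm_le_of_forall_mem_frontier_norm_le`). This is the
one-disc form of zero counting near the centre (Jensen), the mechanism behind "`r ≪ log k²N`".
[cite: Mestre1986FormulesExplicites, Introduction p. 210] -/
theorem norm_le_of_analyticOrderAt_eq {Λ : ℂ → ℂ} (hΛ : Differentiable ℂ Λ) {M R : ℝ}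
    (hR : 0 < R) (hM : ∀ s : ℂ, ‖s - 1‖ = R → ‖Λ s‖ ≤ M) {n : ℕ}
    (hn : analyticOrderAt Λ 1 = n) {z : ℂ} (hz : ‖z - 1‖ ≤ R) :
    ‖Λ z‖ ≤ M / R ^ n * ‖z - 1‖ ^ n := by
  obtain ⟨g, hg, -, hev⟩ := (hΛ.analyticAt 1).analyticOrderAt_eq_natCast.mp hn
  set G : ℂ → ℂ := fun s => if s = 1 then g 1 else Λ s / (s - 1) ^ n with hG
  have hfac : ∀ s : ℂ, Λ s = (s - 1) ^ n * G s := by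
    intro s
    by_cases hs : s = 1
    · subst hs
      have h1 := hev.self_of_nhds
      simpa [hG] using h1
    · have hs' : (s - 1) ^ n ≠ 0 := pow_ne_zero n (sub_ne_zero.mpr hs)
      simp only [hG, hs, if_false]
      field_simp
  have hG1 : G =ᶠ[𝓝 1] g := by
    filter_upwards [hev] with s hs
    by_cases h1 : s = 1
    · simp [hG, h1]
    · have hs' : (s - 1) ^ n ≠ 0 := pow_ne_zero n (sub_ne_zero.mpr h1)
      simp only [hG, h1, if_false, hs, smul_eq_mul]
      field_simp
  have hGd : Differentiable ℂ G := by
    intro z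
    by_cases hz1 : z = 1
    · subst hz1
      exact hg.differentiableAt.congr_of_eventuallyEq hG1
    · have hd : DifferentiableAt ℂ (fun s => Λ s / (s - 1) ^ n) z :=
        (hΛ z).div ((differentiableAt_id.sub_const 1).pow n)
          (pow_ne_zero n (sub_ne_zero.mpr hz1))
      refine hd.congr_of_eventuallyEq ?_
      filter_upwards [eventually_ne_nhds hz1] with s hs
      simp [hG, hs]
  have hfront : ∀ s ∈ frontier (ball (1 : ℂ) R), ‖G s‖ ≤ M / R ^ n := by
    intro s hs
    rw [frontier_ball (1 : ℂ) hR.ne', mem_sphere_iff_norm] at hs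
    have hs1 : s ≠ 1 := by
      rintro rfl
      rw [sub_self, norm_zero] at hs
      exact hR.ne' hs.symm
    have hGs : G s = Λ s / (s - 1) ^ n := by simp [hG, hs1]
    rw [hGs, norm_div, norm_pow, hs]
    exact div_le_div_of_nonneg_right (hM s hs) (pow_nonneg hR.le n)
  have hzc : z ∈ closure (ball (1 : ℂ) R) := by
    rw [closure_ball (1 : ℂ) hR.ne', mem_closedBall, dist_eq_norm]
    exact hz
  have hGz : ‖G z‖ ≤ M / R ^ n :=
    Complex.norm_le_of_forall_mem_frontier_norm_le isBounded_ball hGd.diffContOnCl hfront hzc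
  rw [hfac z, norm_mul, norm_pow, mul_comm]
  exact mul_le_mul_of_nonneg_right hGz (pow_nonneg (norm_nonneg _) n)

/-- **One size datum bounds the central order.** If `Λ` is entire with `‖Λ‖ ≤ M` on the circle
`‖s - 1‖ = R`, `R ≥ 1`, with `m ≤ ‖Λ(2)‖`, and `analyticOrderAt Λ 1 = n`, then `m · Rⁿ ≤ M` —
for `R > 1`, `m > 0`: `n ≤ log(M/m) / log R`. For the completed `L`-function of an elliptic curve
of conductor `N` both data are explicit in `N` (`Λ(E,2) = N L(E,2)/(4π²) > 0` from the Euler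
product; `M` polynomial in `N` by convexity, which uses the functional equation), giving
`ord_{s=1} ≪ log N`, the order of magnitude of the printed unconditional explicit-formula bound
"`r ≪ log k²N`". [cite: Mestre1986FormulesExplicites, Introduction p. 210 and §II.1.1 pp. 216–217] -/
theorem mul_pow_le_of_analyticOrderAt_eq {Λ : ℂ → ℂ} (hΛ : Differentiable ℂ Λ) {M m R : ℝ}
    (hR : 1 ≤ R) (hM : ∀ s : ℂ, ‖s - 1‖ = R → ‖Λ s‖ ≤ M) (hm : m ≤ ‖Λ 2‖) {n : ℕ}
    (hn : analyticOrderAt Λ 1 = n) : m * R ^ n ≤ M := by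
  have hR0 : 0 < R := one_pos.trans_le hR
  have h2 : ‖(2 : ℂ) - 1‖ ≤ R := by norm_num; exact hR
  have key := norm_le_of_analyticOrderAt_eq hΛ hR0 hM hn h2
  rw [show (2 : ℂ) - 1 = 1 by norm_num, norm_one, one_pow, mul_one] at key
  have : m ≤ M / R ^ n := hm.trans key
  rwa [le_div_iff₀ (pow_pos hR0 n)] at this

/-- **Inside the class**: a member of `signedFEClass w` with the two size data has central order
`n` only if `(-1)ⁿ = w` AND `m Rⁿ ≤ M` — parity (old entry) and a bound (this audit).
[cite: Dokchitser2013ParityNotes, §1.1] [cite: Mestre1986FormulesExplicites, Introduction p. 210] -/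
theorem neg_one_pow_eq_and_mul_pow_le_of_mem_signedFEClass {w : ℂ} {Λ : ℂ → ℂ}
    (hΛ : Λ ∈ signedFEClass w) {M m R : ℝ} (hR : 1 ≤ R)
    (hM : ∀ s : ℂ, ‖s - 1‖ = R → ‖Λ s‖ ≤ M) (hm : m ≤ ‖Λ 2‖) {n : ℕ}
    (hn : analyticOrderAt Λ 1 = n) : (-1 : ℂ) ^ n = w ∧ m * R ^ n ≤ M :=
  ⟨(sign_eq_neg_one_pow (hΛ.1.analyticAt 1) hΛ.2.2 hn).symm,
    mul_pow_le_of_analyticOrderAt_eq hΛ.1 hR hM hm hn⟩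

/-- **Sharpness witnesses for the normalised class.** The scaled monomial `m (s - 1)ⁿ` (`m ≠ 0`
real) is entire, real on `ℝ`, satisfies the functional equation with sign `(-1)ⁿ` and has central
order exactly `n`; its size on `‖s - 1‖ = R` is `|m| Rⁿ` and at `s = 2` is `|m|`. [folklore] -/
theorem scaledMonomial_mem_signedFEClass (m : ℝ) (hm : m ≠ 0) (n : ℕ) :
    (fun s : ℂ => (m : ℂ) * (s - 1) ^ n) ∈ signedFEClass ((-1) ^ n) ∧
      analyticOrderAt (fun s : ℂ => (m : ℂ) * (s - 1) ^ n) 1 = n := by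
  obtain ⟨-, hord⟩ := centeredMonomial_mem_signedFEClass n
  refine ⟨⟨by fun_prop, fun x => ?_, fun s => ?_⟩, ?_⟩
  · show ((m : ℂ) * (((x : ℂ)) - 1) ^ n).im = 0
    rw [show ((x : ℂ) - 1) ^ n = (((x - 1) ^ n : ℝ) : ℂ) by push_cast; ring, ← Complex.ofReal_mul]
    exact Complex.ofReal_im _
  · show (m : ℂ) * ((2 : ℂ) - s - 1) ^ n = (-1) ^ n * ((m : ℂ) * (s - 1) ^ n)
    rw [show (2 : ℂ) - s - 1 = (-1) * (s - 1) by ring, mul_pow]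
    ring
  · have e : (fun s : ℂ => (m : ℂ) * (s - 1) ^ n) =
        (fun _ : ℂ => (m : ℂ)) * fun s : ℂ => (s - 1) ^ n := by
      ext s; simp
    have hc : analyticOrderAt (fun _ : ℂ => (m : ℂ)) 1 = 0 :=
      analyticOrderAt_eq_zero.mpr (Or.inr (by exact_mod_cast hm))
    rw [e, analyticOrderAt_mul analyticAt_const (by fun_prop), hc, hord, zero_add]

end NarrowGrowth

section NarrowStatement

/-- **Barrier, NARROWED (audit 2026-08-15): the signed functional equation together with ONE
growth normalisation sees the central order exactly up to "parity + `n ≤ log(M/m)/log R`".**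
For every sign `w`, radius `R ≥ 1`, and sizes `M`, `m > 0`: the set of central orders
`analyticOrderAt Λ 1` realised by members `Λ ∈ signedFEClass w` (entire, real on `ℝ`,
`Λ(2 - s) = w Λ(s)`) that are bounded by `M` on the circle `‖s - 1‖ = R` and satisfy
`m ≤ ‖Λ(2)‖` is EXACTLY `{n | (-1)ⁿ = w ∧ m Rⁿ ≤ M}`. `⊆`: parity (`sign_eq_neg_one_pow`, the old
entry) and the Schwarz/maximum-modulus bound (`mul_pow_le_of_analyticOrderAt_eq`, this audit);
`⊇`: the witnesses `m (s - 1)ⁿ` (`scaledMonomial_mem_signedFEClass`). The old record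
`FunctionalEquationSeesOnlyParity` is the limit `M/m → ∞` (no size datum): growth-blind sign
arguments see parity and nothing else; growth-aware ones see parity and an upper bound of size
`log(conductor)`, and nothing else. PROVED below (`functionalEquationSeesOnlyParityNarrow_holds`).

BARRIER (D-0021), one line per key:
* technique_class: functional-equation / root-number SIGN arguments, growth-aware form — formally the members of `signedFEClass w` (entire, real on `ℝ`, `Λ(2 - s) = w Λ(s)`) normalised by `‖Λ‖ ≤ M` on `‖s - 1‖ = R` (`R ≥ 1`) and `m ≤ ‖Λ(2)‖`; for `Λ(E, s) = W.completedLContinuation N_W` these two data come with the tree facts `differentiable_completedLContinuation`, `completedLContinuation_two_sub` through the DEFINITION of `WeierstrassCurve.completedLContinuations` (agreement with `N^{s/2}(2π)^{-s}Γ(s)L(E,s)` on `Re s > 3/2`: `Λ(E,2) > 0` by the Euler product, `M` polynomial in `N` by convexity, which itself uses the functional equation); any conclusion about `ord_{s=1}` valid for EVERY such `Λ` — i.e. blind to the Dirichlet coefficients beyond these two numbers.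
* blocks: determining `W.analyticRank` — hence `BirchSwinnertonDyer` (`Literature.BSDRankConjecture`) through the analytic side — beyond "parity + `analyticRank ≤ log(M/m)/log R`" by such arguments: as soon as `m R^{n+2} ≤ M` the class contains members of order `n` and `n + 2` alike, so no separation of analytic rank `0` from `2` or `1` from `3` follows for conductors with `log(M/m)/log R ≥ 2`, resp. `≥ 3`, i.e. for all but a bounded conductor range (`M/m` grows like a power of `N`); the growth-blind special case (no size datum, every order of the parity class realised) is the old record `FunctionalEquationSeesOnlyParity` [cite: Dokchitser2013ParityNotes, §1.1] [cite: KellockDokchitser2023, §4]; the quantitative remainder is the printed zero-counting bound `r ≪ log k²N` [cite: Mestre1986FormulesExplicites, Introduction p. 210].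
* because: `⊆`: `Λ(z) = (z - 1)ⁿ g(z)`, `g(1) ≠ 0`, and `Λ(2 - z) = w Λ(z)` give `w = (-1)ⁿ` (`sign_eq_neg_one_pow`) [cite: Dokchitser2013ParityNotes, §1.1]; `Λ(s)/(s - 1)ⁿ` is entire and bounded by `M/Rⁿ` on `‖s - 1‖ = R`, so by the maximum modulus principle `‖Λ(2)‖ ≤ M/Rⁿ` (`norm_le_of_analyticOrderAt_eq`, `mul_pow_le_of_analyticOrderAt_eq`) — the disc form of counting zeros near the centre against the conductor [cite: Mestre1986FormulesExplicites, Introduction p. 210 and §II.1.1 pp. 216–217]; `⊇`: `m (s - 1)ⁿ` is entire, real, has sign `(-1)ⁿ`, order `n`, size `m Rⁿ ≤ M` on the circle and `m` at `2` (`scaledMonomial_mem_signedFEClass`).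
* evasions_known: (i) use the COEFFICIENTS with the functional equation — Weil's explicit formula: unconditionally `r ≤ log k²N` from test functions with `Re Φ ≥ 0` on the critical strip, sharper with the actual `a_p` ("pour de petits niveaux `N`, les majorations obtenues sont généralement assez précises") [cite: Mestre1986FormulesExplicites, §II.1.1 pp. 216–217], under GRH `ord ≤ A log k²N/log log k²N` and first zero at height `≤ B/log log k²N` [cite: Mestre1986FormulesExplicites, Prop. II.1 p. 218], for elliptic curves `r ≤ 0,268 log N + 1,03` from `N` alone and the table of least conductors per rank, improved by one using the parity from the split multiplicative primes [cite: Mestre1986FormulesExplicites, §II.2 pp. 219–221], `r(E) ≤ 11 log T/log log T` [cite: Heathbrown2004, §1], GRH rank certificates for individual curves of huge conductor [cite: Bober2013, §§1–2] [cite: KlagsbrunShermanWeigandt2018, Thm. 1]; (ii) use central VALUES and DERIVATIVES (`L(E,1)/Ω ∈ ℚ`, Gross–Zagier, certified non-vanishing of `L^{(k)}(E,1)`; barrier `NumericalVanishingBarrier`) [cite: Dokchitser2013ParityNotes, §1.1 (BSD I)]; (iii) on the arithmetic side, `p`-parity and parity from finiteness of `Ш[2^∞], Ш[3^∞]` [cite: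 DokchitserDokchitserAnnals2010, Thm. 1.4] [cite: Dokchitser2013ParityNotes, §1.1 Thm. A]; (iv) for non-primitive `L`-functions, root numbers of self-dual FACTORS force `ord_{s=1} L(E/F, s) ≥ n` (Heegner hypothesis, `Gal(F/ℚ) = D_{2n}`) — lower bounds beyond the parity of the single sign `w(E/F)`, outside the single-sign model [cite: KellockDokchitser2023, §3.16 Prop. 3.54].
* scope_caveats: (a) still a relativisation statement: the Euler product, Ramanujan bounds, finite order and automorphy of `Λ(E, s)` are NOT modelled beyond the two numbers `M`, `m`, and nothing here says that the full axiom system cannot constrain `ord_{s=1}` further — in print it does so only through (i) above, never below `O(log N/log log N)` uniformly, and no lower bound beyond parity is known for primitive degree-`2` `L`-functions [cite: KellockDokchitser2023, §4 ("as small as is allowed by the functional equation")]; (b) the size data are hypotheses on the abstract `Λ`; that `Λ(E, s)` satisfies them with `M/m` polynomial in `N` (convexity via Phragmén–Lindelöf, positivity of `L(E,2)`) is standard but not derived in the tree, whose `Λ(E, ·)` exists only through the named fact `differentiable_completedLContinuation`; (c) caveats (b)–(e) of `FunctionalEquationSeesOnlyParity` apply verbatim (only `s ↦ 2 - s` with constant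 sign; `analyticOrderAt Λ(E,·) 1 = W.analyticRank` not re-derived; finite order of vanishing needed; analytic side only); (d) the bound is an UPPER bound only: no growth datum yields a lower bound on the central order beyond parity (the witnesses `m (s - 1)ⁿ` include `n ∈ {0, 1}`).
* status: established (theorem `functionalEquationSeesOnlyParityNarrow_holds`, proved here); audit 2026-08-15 of `FunctionalEquationSeesOnlyParity`: NARROWED

[cite: Dokchitser2013ParityNotes, §1.1] [cite: KellockDokchitser2023, §4]
[cite: Mestre1986FormulesExplicites, Introduction p. 210, §II.1.1 pp. 216–217, §II.2 pp. 219–221] -/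
def FunctionalEquationSeesOnlyParityNarrow : Prop :=
  ∀ (w : ℂ) (M m R : ℝ), 1 ≤ R → 0 < m →
    {n : ℕ | ∃ Λ ∈ signedFEClass w, (∀ s : ℂ, ‖s - 1‖ = R → ‖Λ s‖ ≤ M) ∧ m ≤ ‖Λ 2‖ ∧
        analyticOrderAt Λ 1 = n} =
      {n : ℕ | (-1 : ℂ) ^ n = w ∧ m * R ^ n ≤ M}

/-- **`FunctionalEquationSeesOnlyParityNarrow` holds**: `⊆` is
`neg_one_pow_eq_and_mul_pow_le_of_mem_signedFEClass` (parity + Schwarz/maximum-modulus bound),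
`⊇` is the family of witnesses `m (s - 1)ⁿ` (`scaledMonomial_mem_signedFEClass`).
[cite: Dokchitser2013ParityNotes, §1.1] [cite: Mestre1986FormulesExplicites, Introduction p. 210] -/
theorem functionalEquationSeesOnlyParityNarrow_holds : FunctionalEquationSeesOnlyParityNarrow := by
  intro w M m R hR hm
  ext n
  simp only [Set.mem_setOf_eq]
  constructor
  · rintro ⟨Λ, hΛ, hM, hm2, hord⟩
    exact neg_one_pow_eq_and_mul_pow_le_of_mem_signedFEClass hΛ hR hM hm2 hord
  · rintro ⟨hw, hle⟩
    subst hw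
    refine ⟨_, (scaledMonomial_mem_signedFEClass m hm.ne' n).1, fun s hs => ?_, ?_,
      (scaledMonomial_mem_signedFEClass m hm.ne' n).2⟩
    · show ‖(m : ℂ) * (s - 1) ^ n‖ ≤ M
      rw [norm_mul, norm_pow, hs, Complex.norm_real, Real.norm_eq_abs, abs_of_pos hm]
      exact hle
    · show m ≤ ‖(m : ℂ) * ((2 : ℂ) - 1) ^ n‖
      rw [show (2 : ℂ) - 1 = 1 by norm_num, one_pow, mul_one, Complex.norm_real, Real.norm_eq_abs,
        abs_of_pos hm]

/-- **The old record is the growth-blind limit of the narrowed one**: with the vacuous size data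
`M = m = R = 1` (met by the witnesses `(s - 1)ⁿ`) the narrowed record returns the full parity
class, recovering `centralOrders w = {n | (-1)ⁿ = w}`.
[cite: Dokchitser2013ParityNotes, §1.1] -/
theorem functionalEquationSeesOnlyParity_of_narrow (h : FunctionalEquationSeesOnlyParityNarrow) :
    FunctionalEquationSeesOnlyParity := by
  intro w _
  ext n
  refine ⟨neg_one_pow_eq_of_mem_centralOrders, fun hn => ?_⟩
  have hset := h w 1 1 1 le_rfl one_pos
  have hmem : n ∈ {k : ℕ | (-1 : ℂ) ^ k = w ∧ (1 : ℝ) * 1 ^ k ≤ 1} := ⟨hn, by simp⟩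
  rw [← hset] at hmem
  obtain ⟨Λ, hΛ, -, -, hord⟩ := hmem
  exact ⟨Λ, hΛ, hord⟩

/-- **No separation of `n` from `n + 2` survives while the size budget allows it**: if
`m R^{n+2} ≤ M` (and `(-1)ⁿ = w`), the normalised class contains members of central order `n`
AND `n + 2` — so a growth-aware sign argument separates analytic rank `0` from `2` (or `1` from
`3`) only in the bounded range `M < m R²` (resp. `M < m R³`). [cite: Mestre1986FormulesExplicites, §II.2 pp. 219–221] -/
theorem mem_and_add_two_mem_of_mul_pow_le {w : ℂ} {M m R : ℝ} (hR : 1 ≤ R) (hm : 0 < m) {n : ℕ}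
    (hw : (-1 : ℂ) ^ n = w) (hle : m * R ^ (n + 2) ≤ M) :
    n ∈ {n : ℕ | ∃ Λ ∈ signedFEClass w, (∀ s : ℂ, ‖s - 1‖ = R → ‖Λ s‖ ≤ M) ∧ m ≤ ‖Λ 2‖ ∧
        analyticOrderAt Λ 1 = n} ∧
    n + 2 ∈ {n : ℕ | ∃ Λ ∈ signedFEClass w, (∀ s : ℂ, ‖s - 1‖ = R → ‖Λ s‖ ≤ M) ∧ m ≤ ‖Λ 2‖ ∧
        analyticOrderAt Λ 1 = n} := by
  rw [functionalEquationSeesOnlyParityNarrow_holds w M m R hR hm]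
  refine ⟨⟨hw, le_trans ?_ hle⟩, ⟨by rw [pow_add, hw]; norm_num, hle⟩⟩
  exact mul_le_mul_of_nonneg_left (pow_le_pow_right₀ hR (Nat.le_add_right n 2)) hm.le

end NarrowStatement

end Literature.Barriers.BirchSwinnertonDyer

end
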